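import Literature.NumberTheory.GaloisRepresentations.LubinTateColemanRelativeNormCoherentTwo
import HarnessLib

/-!
# De Shalit's (2)+(3) over an unramified base (`q = 2`): `‖(ψ^{-(n+1)} 𝒩_E^{(m+1)} h)^ι(ω_{n+1}) − N_{m,n}(h^ι(ω_{m+1}))‖ ≤ ‖π‖^{m−n+1}`

De Shalit, *Iwasawa theory of elliptic curves with complex multiplication* (1987), Ch. I §2.2, proof of the Theorem,
formulas (2) and (3), in the RELATIVE situation over `E ⊆ F^{nr}` (finite, normal) for `f = πX + X²` (`|𝓀_F| = 2`),
with `𝒩 = 𝒩_E = relNormTwo` and a Frobenius lift `ψ : 𝒪_E ≃+* 𝒪_E` (`ψ(π) = π`, `ψ(c) ≡ c² mod π`; the genuine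
Frobenius by `LubinTateUnramifiedFrobenius`).  For `h ∈ 𝒪_E⟦X⟧` with unit constant term:

  (3)  `𝒩^{(m+1)} h = ψ^{n+1}(𝒩^{(m−n)} h) · w`,  `w = 𝒩^{(m−n)}(𝒩^{(n+1)}h / ψ^{n+1}h) ≡ 1 (mod π^{m−n+1})`,

by multiplicativity, (ii) `𝒩 ∘ ψ = ψ ∘ 𝒩`, (i) `𝒩^{(k)} h ≡ ψ^k h (mod π)` and (iv); together with (2)
(`LubinTateColemanRelativeNormCoherentTwo.prod_relStab_algEquiv_evS_cohPt`) this gives the KEY ESTIMATE of Coleman's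
interpolation theorem: **`‖(ψ^{-(n+1)} 𝒩^{(m+1)} h)^ι(ι ω_{n+1}) − y'‖ ≤ ‖π‖^{m−n+1}`** where `y'` is the relative norm
`∏_{σ|_E = id, σ ω_{n+1} = ω_{n+1}} σ(h^ι(ω_{m+1}))`.  Everything PROVED (0 sorry):

* `norm_evS_map_le_of_mem_coeffIdeal` — `D ≡ 0 (mod π^j)` ⟹ `‖D^ι(y)‖ ≤ ‖π‖^j`;
  `norm_evS_map_sub_le_of_forall_lt` — `G ≡ G' (mod π^a)` below degree `K` ⟹ `‖G^ι(y) − G'^ι(y)‖ ≤ max ‖π‖^a ‖y‖^K`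
  (continuity of evaluation for the product of the `π`-adic coefficient topologies).
* `relNormTwo_map_iterate` — `𝒩(ψ^k G) = ψ^k(𝒩 G)`; `relNormTwo_iterate_sub_one_mem` — (iv) iterated;
  ★ `exists_relNormTwo_iterate_eq_map_iterate_mul` — **(i) iterated: `𝒩^{(k)} h = ψ^k h · w`, `w ≡ 1 (mod π)`**.
* ★ `exists_relNormTwo_iterate_eq_mul` — **(3): `𝒩^{(m+1)} h = ψ^{n+1}(𝒩^{(m−n)} h) · w`, `w ≡ 1 (mod π^{m−n+1})`**;
  `symm_iterate_map_iterate` — `(ψ⁻¹)^{k} ψ^{k} G = G`; `map_sub_one_mem_coeffIdeal` — ring maps fixing `π` preserve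
  `≡ 1 (mod π^j)`.
* ★★ `norm_evS_symm_iterate_relNormTwo_iterate_sub_le` — the key estimate (displayed above).

## References

* E. de Shalit, *Iwasawa theory of elliptic curves with complex multiplication* (1987), Ch. I §2.1 (i), (ii), (iv);
  §2.2 (2)–(3). [deShalit1987]
* R. Coleman, *Division values in local fields*, Invent. Math. 53 (1979), Thm. A (proof).

## Tree reuse

`norm_aeval_le_of_coeff_le` (`LubinTateColemanLevel`), `relNormTwo_sub_map_mem`, `relNormTwo_sub_one_mem`, `map_relNormTwo`
(`LubinTateColemanRelativeCongruenceTwo`), `isUnit_of_sub_mem_coeffIdeal_span`, `isAdicComplete_span_algebraMap_pi`,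
`relNormTwo_iterate_map`, `relNormTwo_iterate_mul`, `prod_relStab_algEquiv_evS_cohPt`, `inclUnitBall_evS_map`,
`exists_eq_C_mul_of_mem_coeffIdeal_span`, `norm_inclUnitBall`, `norm_algebraMap_LTCoeff`.
-/

noncomputable section

open scoped PowerSeries.WithPiTopology

namespace Literature.NumberTheory.GaloisRepresentations

section RelativeEstimateTwo

open GaloisRepresentations.IsNonarchimedeanLocalField LubinTate ValuativeRel Field

variable (F : Type*) [Field F] [ValuativeRel F] [TopologicalSpace F] [IsNonarchimedeanLocalField F]

attribute [local instance] ltNormUniformSpace ltNormIsUniformAddGroup rk1 nF nE fintypeResidueField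

variable {F}
variable {π : 𝒪[F]} (hπ : (valuation F).IsUniformizer (π : F))
variable (E : IntermediateField F (AlgebraicClosure F)) [FiniteDimensional F E]

/-! ### Values of series with small coefficients -/

/-- `‖π^j‖` read in `𝒪_E` is `‖π‖^j`. [cite: SerreLocalFields1979, Ch. II §2 Cor. 3] -/
theorem norm_algebraMap_pi_pow (j : ℕ) :
    ‖(((algebraMap 𝒪[F] (unitBall E) π ^ j : unitBall E)) : E)‖ = ‖(π : F)‖ ^ j := by
  rw [SubmonoidClass.coe_pow, norm_pow]
  exact congrArg (· ^ j) (norm_algebraMap_LTCoeff E π)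

/-- **`‖D^ι(y)‖ ≤ ‖π‖^j` when `D ≡ 0 (mod π^j)` coefficientwise** (`D ∈ 𝒪_E⟦X⟧`, `ι : 𝒪_E → 𝒪_{E'}` along `E ≤ E'`,
`y ∈ 𝔪_{E'}`). [cite: deShalit1987, Ch. I §2.2 (proof, (3))] -/
theorem norm_evS_map_le_of_mem_coeffIdeal {E' : IntermediateField F (AlgebraicClosure F)} [FiniteDimensional F E']
    (h : E ≤ E') {D : PowerSeries (unitBall E)} {j : ℕ}
    (hD : D ∈ coeffIdeal (Ideal.span {algebraMap 𝒪[F] (unitBall E) π ^ j})) (y : (maxNilIdeal F E').toIdeal) :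
    ‖((evS (maxNilIdeal F E') y (PowerSeries.map (inclUnitBall (F := F) h : unitBall E →+* unitBall E') D) :
        unitBall E') : E')‖ ≤ ‖(π : F)‖ ^ j := by
  obtain ⟨D₁, rfl⟩ := exists_eq_C_mul_of_mem_coeffIdeal_span hD
  have e1 : (inclUnitBall (F := F) h : unitBall E →+* unitBall E') (algebraMap 𝒪[F] (unitBall E) π ^ j) =
      algebraMap 𝒪[F] (unitBall E') π ^ j := by
    rw [map_pow]; exact congrArg (· ^ j) (inclUnitBall_algebraMap_pi h π)
  rw [map_mul, PowerSeries.map_C, map_mul, evS_C, Subring.coe_mul, norm_mul, e1, norm_algebraMap_pi_pow E']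
  calc ‖(π : F)‖ ^ j * _ ≤ ‖(π : F)‖ ^ j * 1 := by gcongr; exact norm_coe_unitBall_le _
    _ = ‖(π : F)‖ ^ j := mul_one _

/-- **`‖G^ι(y) − G'^ι(y)‖ ≤ max ‖π‖^a ‖y‖^K`** when `G ≡ G' (mod π^a)` in all degrees `< K` (`G, G' ∈ 𝒪_E⟦X⟧`): evaluation
at a point of the open unit disc is continuous for the product of the `π`-adic topologies on the coefficients.
[cite: deShalit1987, Ch. I §2.2 (proof, "by continuity")] -/
theorem norm_evS_map_sub_le_of_forall_lt {E' : IntermediateField F (AlgebraicClosure F)} [FiniteDimensional F E']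
    (h : E ≤ E') {G G' : PowerSeries (unitBall E)} {a K : ℕ}
    (hGG' : ∀ k < K, algebraMap 𝒪[F] (unitBall E) π ^ a ∣ PowerSeries.coeff k G - PowerSeries.coeff k G')
    (y : (maxNilIdeal F E').toIdeal) :
    ‖((evS (maxNilIdeal F E') y (PowerSeries.map (inclUnitBall (F := F) h : unitBall E →+* unitBall E') G) :
        unitBall E') : E') -
      ((evS (maxNilIdeal F E') y (PowerSeries.map (inclUnitBall (F := F) h : unitBall E →+* unitBall E') G') :
        unitBall E') : E')‖ ≤ max (‖(π : F)‖ ^ a) (‖((y : unitBall E') : E')‖ ^ K) := by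
  rw [← AddSubgroupClass.coe_sub, ← map_sub, ← map_sub]
  have hy : ‖((y : unitBall E') : E')‖ < 1 := y.2
  change ‖((PowerSeries.aeval (isTopologicallyNilpotent_of_norm_lt_one E' hy)
    (PowerSeries.map (inclUnitBall (F := F) h : unitBall E →+* unitBall E') (G - G')) : unitBall E') : E')‖ ≤ _
  refine norm_aeval_le_of_coeff_le (K := K) _ hy (le_max_of_le_right (pow_nonneg (norm_nonneg _) _))
    (fun k hk => ?_) (le_max_right _ _)
  refine le_trans ?_ (le_max_left _ _)
  rw [PowerSeries.coeff_map, map_sub]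
  obtain ⟨c, hc⟩ := hGG' k hk
  change ‖((inclUnitBall (F := F) h (PowerSeries.coeff k G - PowerSeries.coeff k G') : unitBall E') : E')‖ ≤ _
  rw [norm_inclUnitBall, hc, Subring.coe_mul, norm_mul, norm_algebraMap_pi_pow E]
  calc ‖(π : F)‖ ^ a * _ ≤ ‖(π : F)‖ ^ a * 1 := by gcongr; exact norm_coe_unitBall_le _
    _ = ‖(π : F)‖ ^ a := mul_one _

/-! ### (i), (ii), (iv) iterated -/

variable (hq : residueFieldCard F = 2)

/-- **`𝒩_E(ψ^k G) = ψ^k(𝒩_E G)`** for a ring endomorphism `ψ` of `𝒪_E` fixing `π`.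
[cite: deShalit1987, Ch. I §2.1 Proposition (ii)] -/
theorem relNormTwo_map_iterate {ψ : unitBall E →+* unitBall E}
    (hψ : ψ (algebraMap 𝒪[F] (unitBall E) π) = algebraMap 𝒪[F] (unitBall E) π) (k : ℕ) (G : PowerSeries (unitBall E)) :
    relNormTwo hπ E hq ((PowerSeries.map ψ)^[k] G) = (PowerSeries.map ψ)^[k] (relNormTwo hπ E hq G) := by
  induction k generalizing G with
  | zero => rfl
  | succ k ih => rw [Function.iterate_succ_apply, Function.iterate_succ_apply, ih, map_relNormTwo hπ E hq hψ]

/-- **`𝒩_E^{(j)}(ψ^k G) = ψ^k(𝒩_E^{(j)} G)`.** [cite: deShalit1987, Ch. I §2.1 Proposition (ii)] -/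
theorem relNormTwo_iterate_map_iterate {ψ : unitBall E →+* unitBall E}
    (hψ : ψ (algebraMap 𝒪[F] (unitBall E) π) = algebraMap 𝒪[F] (unitBall E) π) (j k : ℕ) (G : PowerSeries (unitBall E)) :
    (relNormTwo hπ E hq)^[j] ((PowerSeries.map ψ)^[k] G) = (PowerSeries.map ψ)^[k] ((relNormTwo hπ E hq)^[j] G) := by
  induction j generalizing G with
  | zero => rfl
  | succ j ih => rw [Function.iterate_succ_apply, Function.iterate_succ_apply, relNormTwo_map_iterate hπ E hq hψ, ih]

/-- A ring endomorphism fixing `π` preserves `coeffIdeal (π^j)`. [cite: deShalit1987, Ch. I §2.1] -/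
theorem map_mem_coeffIdeal_pow {ψ : unitBall E →+* unitBall E}
    (hψ : ψ (algebraMap 𝒪[F] (unitBall E) π) = algebraMap 𝒪[F] (unitBall E) π) {j : ℕ} {D : PowerSeries (unitBall E)}
    (hD : D ∈ coeffIdeal (Ideal.span {algebraMap 𝒪[F] (unitBall E) π ^ j})) :
    PowerSeries.map ψ D ∈ coeffIdeal (Ideal.span {algebraMap 𝒪[F] (unitBall E) π ^ j}) := by
  intro n
  rw [PowerSeries.coeff_map]
  obtain ⟨c, hc⟩ := Ideal.mem_span_singleton.mp (hD n)
  rw [hc, map_mul, map_pow, hψ]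
  exact Ideal.mem_span_singleton.mpr (dvd_mul_right _ _)

/-- `ψ^k (G − 1) ≡ 0 (mod π^j)` when `G ≡ 1 (mod π^j)`: iterates of `ψ` preserve `≡ 1 (mod π^j)`.
[cite: deShalit1987, Ch. I §2.1] -/
theorem map_iterate_sub_one_mem {ψ : unitBall E →+* unitBall E}
    (hψ : ψ (algebraMap 𝒪[F] (unitBall E) π) = algebraMap 𝒪[F] (unitBall E) π) (k : ℕ) {j : ℕ}
    {w : PowerSeries (unitBall E)} (hw : w - 1 ∈ coeffIdeal (Ideal.span {algebraMap 𝒪[F] (unitBall E) π ^ j})) :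
    (PowerSeries.map ψ)^[k] w - 1 ∈ coeffIdeal (Ideal.span {algebraMap 𝒪[F] (unitBall E) π ^ j}) := by
  induction k with
  | zero => exact hw
  | succ k ih =>
    rw [Function.iterate_succ_apply']
    have e : PowerSeries.map ψ ((PowerSeries.map ψ)^[k] w) - 1 = PowerSeries.map ψ ((PowerSeries.map ψ)^[k] w - 1) := by
      rw [map_sub, map_one]
    rw [e]
    exact map_mem_coeffIdeal_pow E hψ ih

/-- **(iv) iterated: `w ≡ 1 (mod π^i)`, `i ≥ 1` ⟹ `𝒩_E^{(k)} w ≡ 1 (mod π^{i+k})`.**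
[cite: deShalit1987, Ch. I §2.1 Proposition (iv)] -/
theorem relNormTwo_iterate_sub_one_mem (k : ℕ) {i : ℕ} (hi : 1 ≤ i) {w : PowerSeries (unitBall E)}
    (hw : w - 1 ∈ coeffIdeal (Ideal.span {algebraMap 𝒪[F] (unitBall E) π ^ i})) :
    (relNormTwo hπ E hq)^[k] w - 1 ∈ coeffIdeal (Ideal.span {algebraMap 𝒪[F] (unitBall E) π ^ (i + k)}) := by
  induction k with
  | zero => rwa [Function.iterate_zero_apply, add_zero]
  | succ k ih =>
    rw [Function.iterate_succ_apply', ← add_assoc]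
    exact relNormTwo_sub_one_mem hπ E hq (by omega) ih

/-- ★ **(i) iterated: `𝒩_E^{(k)} h = ψ^k h · w` with `w ≡ 1 (mod π)`** for `h` with unit constant term and a Frobenius lift
`ψ` (`ψ(π) = π`, `ψ(c) ≡ c² mod π`).  (`𝒩` is multiplicative, not additive: `𝒩^{(k+1)} h = ψ^k(𝒩h) · 𝒩 w_k =
ψ^{k+1} h · ψ^k(𝒩h/ψh) · 𝒩w_k`.) [cite: deShalit1987, Ch. I §2.1 Proposition (i); §2.2 (3)] -/
theorem exists_relNormTwo_iterate_eq_map_iterate_mul {ψ : unitBall E →+* unitBall E}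
    (hψπ : ψ (algebraMap 𝒪[F] (unitBall E) π) = algebraMap 𝒪[F] (unitBall E) π)
    (hψ : ∀ c : unitBall E, ψ c - c ^ 2 ∈ Ideal.span {algebraMap 𝒪[F] (unitBall E) π})
    {h : PowerSeries (unitBall E)} (hh : IsUnit (PowerSeries.constantCoeff h)) (k : ℕ) :
    ∃ w : PowerSeries (unitBall E), (relNormTwo hπ E hq)^[k] h = (PowerSeries.map ψ)^[k] h * w ∧
      w - 1 ∈ coeffIdeal (Ideal.span {algebraMap 𝒪[F] (unitBall E) π}) := by
  haveI := isAdicComplete_span_algebraMap_pi hπ E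
  -- `𝒩h = ψh · w₁`, `w₁ ≡ 1 (mod π)`
  have hψh : IsUnit (PowerSeries.map ψ h) := by
    rw [PowerSeries.isUnit_iff_constantCoeff, ← PowerSeries.coeff_zero_eq_constantCoeff_apply, PowerSeries.coeff_map,
      PowerSeries.coeff_zero_eq_constantCoeff_apply]
    exact hh.map ψ
  have hNh : IsUnit (relNormTwo hπ E hq h) :=
    isUnit_of_sub_mem_coeffIdeal_span hψh (relNormTwo_sub_map_mem hπ E hq hψ h)
  set w₁ : PowerSeries (unitBall E) := relNormTwo hπ E hq h * ↑hψh.unit⁻¹ with hw₁def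
  have hw₁ : w₁ - 1 ∈ coeffIdeal (Ideal.span {algebraMap 𝒪[F] (unitBall E) π}) := by
    have e : w₁ - 1 = (relNormTwo hπ E hq h - PowerSeries.map ψ h) * ↑hψh.unit⁻¹ := by
      rw [sub_mul, IsUnit.mul_val_inv, hw₁def]
    rw [e]
    exact Ideal.mul_mem_right _ _ (relNormTwo_sub_map_mem hπ E hq hψ h)
  have hN1 : relNormTwo hπ E hq h = PowerSeries.map ψ h * w₁ := by
    rw [hw₁def, mul_left_comm, IsUnit.mul_val_inv, mul_one]
  induction k with
  | zero => exact ⟨1, by rw [Function.iterate_zero_apply, Function.iterate_zero_apply, mul_one], by rw [sub_self]; exact zero_mem _⟩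
  | succ k ih =>
    obtain ⟨w, hw, hw1⟩ := ih
    refine ⟨(PowerSeries.map ψ)^[k] w₁ * relNormTwo hπ E hq w, ?_, ?_⟩
    · rw [Function.iterate_succ_apply', hw, relNormTwo_mul, relNormTwo_map_iterate hπ E hq hψπ, hN1,
        Function.iterate_succ_apply']
      have e : (PowerSeries.map ψ)^[k] (PowerSeries.map ψ h * w₁) =
          (PowerSeries.map ψ)^[k] (PowerSeries.map ψ h) * (PowerSeries.map ψ)^[k] w₁ := by
        rw [← RingHom.coe_pow, map_mul]
      rw [e, ← Function.iterate_succ_apply' (PowerSeries.map ψ), ← Function.iterate_succ_apply (PowerSeries.map ψ)]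
      ring
    · -- `ψ^k w₁ · 𝒩w ≡ 1`: `ψ^k w₁ ≡ 1 (mod π)`, `𝒩 w ≡ 1 (mod π²) ⊆ (mod π)`
      have h1 : (PowerSeries.map ψ)^[k] w₁ - 1 ∈ coeffIdeal (Ideal.span {algebraMap 𝒪[F] (unitBall E) π}) := by
        have := map_iterate_sub_one_mem E hψπ k (j := 1) (w := w₁) (by rwa [pow_one])
        rwa [pow_one] at this
      have h2 : relNormTwo hπ E hq w - 1 ∈ coeffIdeal (Ideal.span {algebraMap 𝒪[F] (unitBall E) π}) := by
        have h2' := relNormTwo_sub_one_mem hπ E hq (i := 1) (le_refl 1) (h := w) (by rwa [pow_one])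
        exact coeffIdeal_mono (Ideal.span_singleton_le_span_singleton.mpr (dvd_pow_self _ two_ne_zero)) h2'
      have e : (PowerSeries.map ψ)^[k] w₁ * relNormTwo hπ E hq w - 1 =
          ((PowerSeries.map ψ)^[k] w₁ - 1) * relNormTwo hπ E hq w + (relNormTwo hπ E hq w - 1) := by ring
      rw [e]
      exact add_mem (Ideal.mul_mem_right _ _ h1) h2

/-- ★ **De Shalit's (3): `𝒩^{(m+1)} h = ψ^{n+1}(𝒩^{(m−n)} h) · w` with `w ≡ 1 (mod π^{m−n+1})`** (`n ≤ m`, `h` with unit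
constant term). [cite: deShalit1987, Ch. I §2.2 (3)] -/
theorem exists_relNormTwo_iterate_eq_mul {ψ : unitBall E →+* unitBall E}
    (hψπ : ψ (algebraMap 𝒪[F] (unitBall E) π) = algebraMap 𝒪[F] (unitBall E) π)
    (hψ : ∀ c : unitBall E, ψ c - c ^ 2 ∈ Ideal.span {algebraMap 𝒪[F] (unitBall E) π})
    {h : PowerSeries (unitBall E)} (hh : IsUnit (PowerSeries.constantCoeff h)) {n m : ℕ} (hnm : n ≤ m) :
    ∃ w : PowerSeries (unitBall E),
      (relNormTwo hπ E hq)^[m + 1] h = (PowerSeries.map ψ)^[n + 1] ((relNormTwo hπ E hq)^[m - n] h) * w ∧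
      w - 1 ∈ coeffIdeal (Ideal.span {algebraMap 𝒪[F] (unitBall E) π ^ (m - n + 1)}) := by
  obtain ⟨r, hr, hr1⟩ := exists_relNormTwo_iterate_eq_map_iterate_mul hπ E hq hψπ hψ hh (n + 1)
  refine ⟨(relNormTwo hπ E hq)^[m - n] r, ?_, ?_⟩
  · have e : (relNormTwo hπ E hq)^[m + 1] h = (relNormTwo hπ E hq)^[m - n] ((relNormTwo hπ E hq)^[n + 1] h) := by
      rw [← Function.iterate_add_apply, show m - n + (n + 1) = m + 1 by omega]
    rw [e, hr, relNormTwo_iterate_mul, relNormTwo_iterate_map_iterate hπ E hq hψπ]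
  · have := relNormTwo_iterate_sub_one_mem hπ E hq (m - n) (le_refl 1) (w := r) (by rwa [pow_one])
    rwa [show 1 + (m - n) = m - n + 1 by omega] at this

/-- `ψ⁻¹` fixes `π` when `ψ` does. [cite: deShalit1987, Ch. I §2.2] -/
theorem symm_algebraMap_pi {ψ : unitBall E ≃+* unitBall E}
    (hψπ : (ψ : unitBall E →+* unitBall E) (algebraMap 𝒪[F] (unitBall E) π) = algebraMap 𝒪[F] (unitBall E) π) :
    (ψ.symm : unitBall E →+* unitBall E) (algebraMap 𝒪[F] (unitBall E) π) = algebraMap 𝒪[F] (unitBall E) π := by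
  change ψ.symm (algebraMap 𝒪[F] (unitBall E) π) = algebraMap 𝒪[F] (unitBall E) π
  rw [RingEquiv.symm_apply_eq]
  exact hψπ.symm

/-- `(ψ⁻¹)^k (ψ^k G) = G`. [cite: deShalit1987, Ch. I §2.2] -/
theorem symm_iterate_map_iterate (ψ : unitBall E ≃+* unitBall E) (k : ℕ) (G : PowerSeries (unitBall E)) :
    (PowerSeries.map (ψ.symm : unitBall E →+* unitBall E))^[k] ((PowerSeries.map (ψ : unitBall E →+* unitBall E))^[k] G) = G := by
  induction k generalizing G with
  | zero => rfl
  | succ k ih =>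
    rw [Function.iterate_succ_apply', Function.iterate_succ_apply, ih]
    refine PowerSeries.ext fun n => ?_
    rw [PowerSeries.coeff_map, PowerSeries.coeff_map]
    exact ψ.symm_apply_apply _

/-- `(ψ⁻¹)^k` is multiplicative on series (it is an iterate of a ring map). [cite: deShalit1987, Ch. I §2.2] -/
theorem map_iterate_mul (ψ : unitBall E →+* unitBall E) (k : ℕ) (G H : PowerSeries (unitBall E)) :
    (PowerSeries.map ψ)^[k] (G * H) = (PowerSeries.map ψ)^[k] G * (PowerSeries.map ψ)^[k] H := by
  rw [← RingHom.coe_pow, map_mul]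

/-! ### The key estimate -/

variable [Normal F E] (hE : E ≤ maxUnramified F)

set_option maxHeartbeats 400000 in
include hE in
open scoped Classical in
/-- ★★ **De Shalit's (2)+(3) over `𝒪_E`**: let `h ∈ 𝒪_E⟦X⟧` have unit constant term, `ψ : 𝒪_E ≃ 𝒪_E` a Frobenius lift
(`ψ(π) = π`, `ψ(c) ≡ c² mod π`), `n ≤ m`, and let `y'` be the norm of `h^ι(ω_{m+1})` from `E·K_π^{m+1}` down to `E·K_π^{n+1}`
(the product over `σ|_E = id`, `σ(ι ω_{n+1}) = ι ω_{n+1}`).  Then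
`‖((ψ⁻¹)^{n+1} 𝒩_E^{(m+1)} h)^ι(ι ω_{n+1}) − y'‖ ≤ ‖π‖^{m−n+1}`.
[cite: deShalit1987, Ch. I §2.2 (proof, (2)–(3))] -/
theorem norm_evS_symm_iterate_relNormTwo_iterate_sub_le {ψ : unitBall E ≃+* unitBall E}
    (hψπ : (ψ : unitBall E →+* unitBall E) (algebraMap 𝒪[F] (unitBall E) π) = algebraMap 𝒪[F] (unitBall E) π)
    (hψ : ∀ c : unitBall E, (ψ : unitBall E →+* unitBall E) c - c ^ 2 ∈ Ideal.span {algebraMap 𝒪[F] (unitBall E) π})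
    {h : PowerSeries (unitBall E)} (hh : IsUnit (PowerSeries.constantCoeff h)) {n m : ℕ} (hnm : n ≤ m)
    {y' : (E ⊔ ltField π m : IntermediateField F (AlgebraicClosure F))}
    (hy' : ∏ σ ∈ Finset.univ.filter (fun σ : (E ⊔ ltField π m : IntermediateField F (AlgebraicClosure F)) ≃ₐ[F]
        (E ⊔ ltField π m : IntermediateField F (AlgebraicClosure F)) =>
        (∀ x : E, σ (IntermediateField.inclusion le_sup_left x) = IntermediateField.inclusion le_sup_left x) ∧
          mapPt σ (inclPt (sup_le_sup_left (ltField_mono hπ hnm) E)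
              (inclPt (le_sup_right : ltField π n ≤ E ⊔ ltField π n) (cohPt hπ n))) =
            inclPt (sup_le_sup_left (ltField_mono hπ hnm) E)
              (inclPt (le_sup_right : ltField π n ≤ E ⊔ ltField π n) (cohPt hπ n))),
      σ ((evS (maxNilIdeal F (E ⊔ ltField π m : IntermediateField F (AlgebraicClosure F)))
          (inclPt (le_sup_right : ltField π m ≤ E ⊔ ltField π m) (cohPt hπ m))
          (PowerSeries.map (inclUnitBall (F := F) (le_sup_left : E ≤ E ⊔ ltField π m) :
            unitBall E →+* unitBall (E ⊔ ltField π m : IntermediateField F (AlgebraicClosure F))) h) :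
          unitBall (E ⊔ ltField π m : IntermediateField F (AlgebraicClosure F))) :
          (E ⊔ ltField π m : IntermediateField F (AlgebraicClosure F))) = y') :
    ‖((evS (maxNilIdeal F (E ⊔ ltField π m : IntermediateField F (AlgebraicClosure F)))
          (inclPt (sup_le_sup_left (ltField_mono hπ hnm) E)
            (inclPt (le_sup_right : ltField π n ≤ E ⊔ ltField π n) (cohPt hπ n)))
          (PowerSeries.map (inclUnitBall (F := F) (le_sup_left : E ≤ E ⊔ ltField π m) :
            unitBall E →+* unitBall (E ⊔ ltField π m : IntermediateField F (AlgebraicClosure F)))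
            ((PowerSeries.map (ψ.symm : unitBall E →+* unitBall E))^[n + 1] ((relNormTwo hπ E hq)^[m + 1] h))) :
          unitBall (E ⊔ ltField π m : IntermediateField F (AlgebraicClosure F))) :
          (E ⊔ ltField π m : IntermediateField F (AlgebraicClosure F))) - y'‖ ≤ ‖(π : F)‖ ^ (m - n + 1) := by
  -- (3): `𝒩^{(m+1)} h = ψ^{n+1}(𝒩^{(m-n)} h) · w`
  obtain ⟨w, hw, hw1⟩ := exists_relNormTwo_iterate_eq_mul hπ E hq hψπ hψ hh hnm
  have hsplit : (PowerSeries.map (ψ.symm : unitBall E →+* unitBall E))^[n + 1] ((relNormTwo hπ E hq)^[m + 1] h) =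
      (relNormTwo hπ E hq)^[m - n] h * (PowerSeries.map (ψ.symm : unitBall E →+* unitBall E))^[n + 1] w := by
    rw [hw, map_iterate_mul, symm_iterate_map_iterate]
  have hw1' : (PowerSeries.map (ψ.symm : unitBall E →+* unitBall E))^[n + 1] w - 1 ∈
      coeffIdeal (Ideal.span {algebraMap 𝒪[F] (unitBall E) π ^ (m - n + 1)}) :=
    map_iterate_sub_one_mem E (symm_algebraMap_pi E hψπ) (n + 1) hw1
  -- (2): the value of `𝒩^{(m-n)} h` at `ι ω_{n+1}` is `y'`
  have h2 : ((evS (maxNilIdeal F (E ⊔ ltField π m : IntermediateField F (AlgebraicClosure F)))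
      (inclPt (sup_le_sup_left (ltField_mono hπ hnm) E)
        (inclPt (le_sup_right : ltField π n ≤ E ⊔ ltField π n) (cohPt hπ n)))
      (PowerSeries.map (inclUnitBall (F := F) (le_sup_left : E ≤ E ⊔ ltField π m) :
        unitBall E →+* unitBall (E ⊔ ltField π m : IntermediateField F (AlgebraicClosure F)))
        ((relNormTwo hπ E hq)^[m - n] h)) :
      unitBall (E ⊔ ltField π m : IntermediateField F (AlgebraicClosure F))) :
      (E ⊔ ltField π m : IntermediateField F (AlgebraicClosure F))) = y' := by
    rw [← hy', prod_relStab_algEquiv_evS_cohPt hπ E m hE hq hnm h,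
      inclUnitBall_evS_map E (le_sup_left : E ≤ E ⊔ ltField π n) (le_sup_left : E ≤ E ⊔ ltField π m)]
  -- the value of `(ψ⁻¹)^{n+1} w` at the point is `1 + O(π^{m-n+1})`
  have h3 : ‖((evS (maxNilIdeal F (E ⊔ ltField π m : IntermediateField F (AlgebraicClosure F)))
      (inclPt (sup_le_sup_left (ltField_mono hπ hnm) E)
        (inclPt (le_sup_right : ltField π n ≤ E ⊔ ltField π n) (cohPt hπ n)))
      (PowerSeries.map (inclUnitBall (F := F) (le_sup_left : E ≤ E ⊔ ltField π m) :
        unitBall E →+* unitBall (E ⊔ ltField π m : IntermediateField F (AlgebraicClosure F)))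
        ((PowerSeries.map (ψ.symm : unitBall E →+* unitBall E))^[n + 1] w)) :
      unitBall (E ⊔ ltField π m : IntermediateField F (AlgebraicClosure F))) :
      (E ⊔ ltField π m : IntermediateField F (AlgebraicClosure F))) - 1‖ ≤ ‖(π : F)‖ ^ (m - n + 1) := by
    have e := norm_evS_map_le_of_mem_coeffIdeal E (le_sup_left : E ≤ E ⊔ ltField π m) hw1'
      (inclPt (sup_le_sup_left (ltField_mono hπ hnm) E)
        (inclPt (le_sup_right : ltField π n ≤ E ⊔ ltField π n) (cohPt hπ n)))
    rwa [map_sub, map_one, map_sub, map_one, AddSubgroupClass.coe_sub, OneMemClass.coe_one] at e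
  rw [hsplit, map_mul, map_mul, Subring.coe_mul, h2]
  have e2 : ∀ z : (E ⊔ ltField π m : IntermediateField F (AlgebraicClosure F)), y' * z - y' = y' * (z - 1) := fun z => by ring
  rw [e2, norm_mul]
  have hy'le : ‖y'‖ ≤ 1 := by rw [← h2]; exact norm_coe_unitBall_le _
  calc ‖y'‖ * _ ≤ 1 * ‖(π : F)‖ ^ (m - n + 1) := mul_le_mul hy'le h3 (norm_nonneg _) zero_le_one
    _ = _ := one_mul _

end RelativeEstimateTwo

end Literature.NumberTheory.GaloisRepresentations
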